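import Summits.Ventures.Crystal3D.Theorems.StickyWulffConstantTextureLiminfTentBarlowFrames
import Summits.Ventures.Crystal3D.Theorems.StickyWulffConstantGenericWallFloorRigidRung
import HarnessLib

/-!
# The broken-bond identity for a subset of a moved Barlow stacking: `2·D(X) = #{(x, y) : x ∈ X, y ∈ S ∖ X, |x − y| = 1}`
# (lane T, the first piece of the currency bridge `BilayerWallAt` ↔ lane G's walker ledger; route `StickyWulffConstant`)

HONEST FRAMING. Venture `Summits/Ventures/Crystal3D` (cell `crystal3d-full`), helper for the crux `TextureLiminf`
(stmt-Ventures-19483) of `route-Ventures-StickyWulffConstant`, registered line `TexShadow` (v6.4, cf-p1 ROUTE §86(23) R: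
the wall stub `stub_bilayerWallGeneric` is lane G's per-top walker ledger in T's currency — cross bonds, `contactDeficiency`
of the filling, `innerBonds` of the Barlow plates).  Rung credit only; F-C1 not moved.  This file proves the one identity
every version of that glue uses and which the line's vocabulary file (`…TexShadowCertificateDefs`, docstring of
`brokenNearIn`: «for `U = univ` this is `2·D_S(X)`») asserts without proof:

* `ncard_touching_stacking_eq_twelve` — a site of the moved stacking `stacking L s σ` (`IsHaggSeq σ`) has exactly twelve
  sites of the stacking at distance `1` (transport of `ncard_touching_eq_twelve`);
* `card_contacts_add_ncard_vacant` — for `X ⊆ stacking L s σ` and `x ∈ X`: `#{q ∈ X : |x−q| = 1} + #{y ∈ S ∖ X : |x−y| = 1} = 12`;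
* **`two_mul_contactDeficiency_eq_sum_vacant`** — `2·D(X) = Σ_{x ∈ X} #{y ∈ S : |x − y| = 1, y ∉ X}` for every finite
  `X ⊆ S = stacking L s σ`: the deficiency of a Barlow sample IS half its number of bonds to vacant sites
  (`= ½·innerBonds S X (· ∉ X)` in the skeleton's notation).
WHAT THIS IS NOT: not the wall law, not the sample-deficit estimate with areas; F-C1 not moved.
-/

noncomputable section

namespace Summit.Ventures.Crystal3D.Theorems

open Finset Summit.Ventures.Crystal3D
open Literature.MathematicalPhysics.StatisticalMechanics (barlowStacking IsHaggSeq orderedContacts contactDeficiency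
  ncard_touching_eq_twelve)
open Summit.Ventures.Crystal3D.Cruxes.TextureLiminf.TexShadow (E3 stacking)
open Summit.Ventures.Crystal3D.TentCertificate (hB hB_sq finite_touching)

/-- **Twelve neighbours in a moved stacking.** -/
theorem ncard_touching_stacking_eq_twelve {L : E3 ≃ₗᵢ[ℝ] E3} {s : E3} {σ : ℤ → ℤ} (hσ : IsHaggSeq σ) {x : E3}
    (hx : x ∈ stacking L s σ) : {y | y ∈ stacking L s σ ∧ dist x y = 1}.ncard = 12 := by
  obtain ⟨r, hr, rfl⟩ := hx
  have h12 := ncard_touching_eq_twelve (a := 1) (h := hB) hσ one_pos (by rw [hB_sq]; norm_num) hr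
  show {y | y ∈ stacking L s σ ∧ dist (L r + s) y = 1}.ncard = 12
  have hset : {y | y ∈ stacking L s σ ∧ dist (L r + s) y = 1} =
      (fun w => L w + s) '' {w | w ∈ barlowStacking 1 hB σ ∧ dist r w = 1} := by
    ext y
    constructor
    · rintro ⟨⟨w, hw, rfl⟩, hd⟩
      refine ⟨w, ⟨hw, ?_⟩, rfl⟩
      rwa [dist_add_right, L.dist_map] at hd
    · rintro ⟨w, ⟨hw, hd⟩, rfl⟩
      refine ⟨⟨w, hw, rfl⟩, ?_⟩
      rwa [dist_add_right, L.dist_map]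
  have hinj : Function.Injective fun w : E3 => L w + s := fun a b hab => L.injective (add_right_cancel hab)
  rw [hset, Set.ncard_image_of_injective _ hinj, ← h12]

/-- **Occupied plus vacant neighbours make twelve**: for `X ⊆ S` and `x ∈ X`,
`#{q ∈ X : |x − q| = 1} + #{y ∈ S : |x − y| = 1, y ∉ X} = 12`. -/
theorem card_contacts_add_ncard_vacant {L : E3 ≃ₗᵢ[ℝ] E3} {s : E3} {σ : ℤ → ℤ} (hσ : IsHaggSeq σ)
    {X : Finset E3} (hX : (↑X : Set E3) ⊆ stacking L s σ) {x : E3} (hx : x ∈ X) :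
    (X.filter fun q => dist x q = 1).card + {y | y ∈ stacking L s σ ∧ dist x y = 1 ∧ y ∉ X}.ncard = 12 := by
  classical
  have hfin := finite_touching hσ (hX hx)
  have h12 := ncard_touching_stacking_eq_twelve hσ (hX hx)
  -- split the touching set into occupied and vacant parts
  have hsplit : {y | y ∈ stacking L s σ ∧ dist x y = 1} =
      {y | y ∈ stacking L s σ ∧ dist x y = 1 ∧ y ∈ X} ∪ {y | y ∈ stacking L s σ ∧ dist x y = 1 ∧ y ∉ X} := by
    ext y; constructor
    · rintro ⟨hy, hd⟩; by_cases h : y ∈ X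
      · exact Or.inl ⟨hy, hd, h⟩
      · exact Or.inr ⟨hy, hd, h⟩
    · rintro (⟨hy, hd, -⟩ | ⟨hy, hd, -⟩) <;> exact ⟨hy, hd⟩
  have hdisj : Disjoint {y | y ∈ stacking L s σ ∧ dist x y = 1 ∧ y ∈ X}
      {y | y ∈ stacking L s σ ∧ dist x y = 1 ∧ y ∉ X} :=
    Set.disjoint_left.2 fun y h1 h2 => h2.2.2 h1.2.2
  have hocc : {y | y ∈ stacking L s σ ∧ dist x y = 1 ∧ y ∈ X} = ↑(X.filter fun q => dist x q = 1) := by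
    ext y
    simp only [Set.mem_setOf_eq, Finset.coe_filter]
    constructor
    · rintro ⟨-, hd, hy⟩; exact ⟨hy, hd⟩
    · rintro ⟨hy, hd⟩; exact ⟨hX hy, hd, hy⟩
  have hfin1 : {y | y ∈ stacking L s σ ∧ dist x y = 1 ∧ y ∈ X}.Finite := hfin.subset fun y hy => ⟨hy.1, hy.2.1⟩
  have hfin2 : {y | y ∈ stacking L s σ ∧ dist x y = 1 ∧ y ∉ X}.Finite := hfin.subset fun y hy => ⟨hy.1, hy.2.1⟩
  rw [hsplit, Set.ncard_union_eq hdisj hfin1 hfin2, hocc, Set.ncard_coe_finset] at h12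
  exact h12

/-- **The broken-bond identity**: for a finite subset `X` of a moved Barlow stacking `S`,
`2·D(X) = Σ_{x ∈ X} #{y ∈ S : |x − y| = 1, y ∉ X}` — the deficiency is half the number of bonds from `X` to vacant sites. -/
theorem two_mul_contactDeficiency_eq_sum_vacant {L : E3 ≃ₗᵢ[ℝ] E3} {s : E3} {σ : ℤ → ℤ} (hσ : IsHaggSeq σ)
    {X : Finset E3} (hX : (↑X : Set E3) ⊆ stacking L s σ) :
    2 * contactDeficiency X = ∑ x ∈ X, ({y | y ∈ stacking L s σ ∧ dist x y = 1 ∧ y ∉ X}.ncard : ℝ) := by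
  rw [two_mul_contactDeficiency_eq_sum]
  refine Finset.sum_congr rfl fun x hx => ?_
  have h := card_contacts_add_ncard_vacant hσ hX hx
  have h' : (((X.filter fun q => dist x q = 1).card : ℕ) : ℝ) +
      (({y | y ∈ stacking L s σ ∧ dist x y = 1 ∧ y ∉ X}.ncard : ℕ) : ℝ) = 12 := by exact_mod_cast h
  linarith

end Summit.Ventures.Crystal3D.Theorems

end
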